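import Mathlib
import Summits.ValiantsHypothesis.ValiantsHypothesis.Theorems.LiouvilleSarnakLiouvilleCutRankTwoAdicTwin

/-!
# Route LiouvilleSarnak — crux `LiouvilleCutRank` (stmt-ValiantsHypothesis-14775): the two-adic twin has cut rank
# `≥ #R-runs` and `≥ #C-runs` on EVERY cut (census item R75-M2: the currency of "Conjecture C")

`Theorems/LiouvilleSarnakLiouvilleCutRankTwoAdicTwin.lean` (p830177) and `…TwoAdicTwinAllCuts.lean` (p830227) bracket the
cut rank of the two-adic sign `f₀(m) = (-1)^{v₂(m)}` — the simplest completely multiplicative twin of `λ` with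
`f₀(2) = λ(2) = -1` — between `1` and `n + 1` on every cut, with `n + 1` attained on the bit-interleaving `(CR)^n` and
`≤ 2` on the aligned cut.  The census of the item (leafhand-2 g6, REQUESTS.md 2026-08-31T17:52Z, R75-M1/M2) phrased the
residual class of the crux as "CONJECTURE C": for a completely multiplicative `±1`-valued `f` with `f(2) = -1` the cut
rank should be `≥ c · #runs(w)` in the number of runs of the cut word `w`; and asked (R75-M2) for the calibrating lower
bound for `f₀` on an ARBITRARY cut.  This file proves it, with constant `1` per letter:

* `twoAdicSign_entry_threshold` — the THRESHOLD rows/columns `𝟙[row position < a]`, `𝟙[column position < b]`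
  (`a` not a column position, `b` not a row position, `a, b ≤ 2n`) have entry `f₀(N + 1) = (-1)^{min(a,b)}`: the
  bits of `N` below `min(a,b)` are `1` and the bit at `min(a,b)` is `0`.
* ★ `card_rowRunTops_le_rank_twoAdicSign` — for every level `n` and EVERY cut `π`, the number of TOPS OF ROW RUNS
  (row positions `p` such that `p + 1` is not a row position) is at most the rank of `(f₀(N_π(r,c)+1))_{r,c}`.
  Proof: list the tops `a₁ < ⋯ < a_t`; on the threshold rows `a_i` and `2n` and the threshold columns `a_k + 1` the
  entries are `(-1)^{min(a_i, a_k+1)}` and `(-1)^{a_k+1}`; subtracting the row `2n` from the row `a_i` gives an upper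
  triangular `t × t` matrix (`a_k + 1 < a_i` for `k < i`, as `a_k + 1` is not a row position) with diagonal
  `2 (-1)^{a_i} ≠ 0`, i.e. `D = L · Q` nonsingular with `Q` a submatrix of `M_π`, so `t = rank D ≤ rank Q ≤ rank M_π`.
* ★ `card_colRunTops_le_rank_twoAdicSign` — the same with the tops of COLUMN runs (transpose: the swapped cut).

So `max(#R-runs, #C-runs) ≤ rank_π(f₀) ≤ n + 1` on every cut word: the two-adic mechanism `f(2m) = -f(m)` ALONE already
produces rank of the order of the number of runs, uniformly over all cuts (and nothing more, by p830227) — which is the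
rate Conjecture C posits for every completely multiplicative `f` with `f(2) = -1`; for `λ` the bounded-run (many-runs)
words are exactly the residual class of `LiouvilleCutRank`, while its few-runs words are the classes already proved from
non-automaticity (`…AlignedWindow`, `…StrayRows`, `…LongRun`, `…BoundedChanges`).  Honest framing: a calibration theorem
about the twin `f₀`, not a case of the crux; `LiouvilleCutRank`, `DigitalBilinearLiouville`, `AlgebraicSarnak` stay OPEN;
nothing here bears on `VP ≠ VNP`.  No definitions (`f₀` is the explicit term `(-1) ^ (m.factorization 2)`).
-/

set_option linter.dupNamespace false

noncomputable section

namespace Summit.ValiantsHypothesis.ValiantsHypothesis.Theorems.LiouvilleSarnakLiouvilleCutRank.TwoAdicTwinRuns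

open Finset

open Summit.ValiantsHypothesis.ValiantsHypothesis.Theorems.LiouvilleSarnakLiouvilleCutRank.TwoAdicTwin
  (twoAdicSign_ofBits_succ)

/-! ### §1 Threshold rows and columns -/

/-- **Entries on threshold rows/columns.**  For a cut `π` of the `2n` positions, the row `𝟙[row position < a]` and the
column `𝟙[column position < b]` — where `a ≤ 2n` is not a column position and `b ≤ 2n` is not a row position — meet in
the entry `f₀(N + 1) = (-1)^{min(a,b)}`: all bits of `N` below `min(a,b)` are `1` and the bit at `min(a,b)` (if
`< 2n`) is `0`. [this file] -/
theorem twoAdicSign_entry_threshold (n : ℕ) (π : Fin n ⊕ Fin n ≃ Fin (2 * n)) (a b : ℕ) (ha : a ≤ 2 * n)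
    (hb : b ≤ 2 * n) (haC : ∀ i : Fin n, (π (Sum.inr i) : ℕ) ≠ a) (hbR : ∀ i : Fin n, (π (Sum.inl i) : ℕ) ≠ b) :
    (-1 : ℂ) ^ ((Nat.ofBits (fun k : Fin (2 * n) =>
        Sum.elim (fun i : Fin n => decide ((π (Sum.inl i) : ℕ) < a))
          (fun i : Fin n => decide ((π (Sum.inr i) : ℕ) < b)) (π.symm k)) + 1).factorization 2) =
      (-1) ^ (min a b) := by
  have hposl : ∀ (j : Fin (2 * n)) (i : Fin n), π.symm j = Sum.inl i → (π (Sum.inl i) : ℕ) = j := by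
    intro j i h
    have : π (Sum.inl i) = j := by rw [← h, Equiv.apply_symm_apply]
    rw [this]
  have hposr : ∀ (j : Fin (2 * n)) (i : Fin n), π.symm j = Sum.inr i → (π (Sum.inr i) : ℕ) = j := by
    intro j i h
    have : π (Sum.inr i) = j := by rw [← h, Equiv.apply_symm_apply]
    rw [this]
  refine twoAdicSign_ofBits_succ (R := ℂ) _ (min a b) (by omega) ?_ ?_
  · intro j hj
    rcases h : π.symm j with i | i
    · have := hposl j i h
      simp only [Sum.elim_inl, decide_eq_true_eq]
      omega
    · have := hposr j i h
      simp only [Sum.elim_inr, decide_eq_true_eq]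
      omega
  · intro j hj
    rcases h : π.symm j with i | i
    · have h1 := hposl j i h
      have h2 := hbR i
      simp only [Sum.elim_inl, decide_eq_false_iff_not, not_lt]
      rcases Nat.le_total a b with hab | hab
      · rw [min_eq_left hab] at hj; omega
      · rw [min_eq_right hab] at hj; omega
    · have h1 := hposr j i h
      have h2 := haC i
      simp only [Sum.elim_inr, decide_eq_false_iff_not, not_lt]
      rcases Nat.le_total a b with hab | hab
      · rw [min_eq_left hab] at hj; omega
      · rw [min_eq_right hab] at hj; omega

/-! ### §2 Tops of row runs give an upper triangular minor -/

/-- ★ **The two-adic twin has cut rank `≥ #(tops of row runs)` on EVERY cut.**  For every level `n` and every cut `π`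
of the `2n` bit positions, the number of row positions `p` whose successor `p + 1` is not a row position (the tops of
the maximal runs of row letters in the cut word; their number is the number of row runs) is at most the rank of the
cut matrix `(f₀(N_π(r,c) + 1))_{r,c}` of `f₀(m) = (-1)^{v₂(m)}`. [this file] -/
theorem card_rowRunTops_le_rank_twoAdicSign (n : ℕ) (π : Fin n ⊕ Fin n ≃ Fin (2 * n)) :
    (Finset.univ.filter fun i : Fin n =>
        ∀ i' : Fin n, (π (Sum.inl i') : ℕ) ≠ (π (Sum.inl i) : ℕ) + 1).card ≤
      (Matrix.of fun r c : Fin n → Bool =>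
        (-1 : ℂ) ^ ((Nat.ofBits (fun k : Fin (2 * n) => Sum.elim r c (π.symm k)) + 1).factorization 2)).rank := by
  classical
  set M := (Matrix.of fun r c : Fin n → Bool =>
      (-1 : ℂ) ^ ((Nat.ofBits (fun k : Fin (2 * n) => Sum.elim r c (π.symm k)) + 1).factorization 2)) with hM
  set T := (Finset.univ.filter fun i : Fin n =>
      ∀ i' : Fin n, (π (Sum.inl i') : ℕ) ≠ (π (Sum.inl i) : ℕ) + 1) with hT
  -- the set of top positions, as natural numbers
  set S : Finset ℕ := T.image fun i => (π (Sum.inl i) : ℕ) with hS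
  have hρinj : Function.Injective fun i : Fin n => (π (Sum.inl i) : ℕ) := by
    intro i i' h
    have h' : π (Sum.inl i) = π (Sum.inl i') := Fin.ext h
    exact Sum.inl_injective (π.injective h')
  have hcardS : S.card = T.card := Finset.card_image_of_injective _ hρinj
  set t := S.card with ht
  -- the sorted tops `a 0 < a 1 < ⋯ < a (t-1)`
  set a : Fin t ↪o ℕ := S.orderEmbOfFin rfl with ha_def
  have ha_mem : ∀ k : Fin t, a k ∈ S := fun k => Finset.orderEmbOfFin_mem S rfl k
  have ha_spec : ∀ k : Fin t, ∃ i : Fin n, (π (Sum.inl i) : ℕ) = a k ∧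
      ∀ i' : Fin n, (π (Sum.inl i') : ℕ) ≠ a k + 1 := by
    intro k
    have hk := ha_mem k
    simp only [hS, Finset.mem_image, hT, Finset.mem_filter, Finset.mem_univ, true_and] at hk
    obtain ⟨i, hi, hia⟩ := hk
    exact ⟨i, hia, fun i' => hia ▸ hi i'⟩
  have ha_row : ∀ k : Fin t, ∃ i : Fin n, (π (Sum.inl i) : ℕ) = a k := fun k =>
    (ha_spec k).imp fun _ h => h.1
  have ha_top : ∀ k : Fin t, ∀ i' : Fin n, (π (Sum.inl i') : ℕ) ≠ a k + 1 := by
    intro k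
    obtain ⟨_, -, h⟩ := ha_spec k
    exact h
  have ha_lt : ∀ k : Fin t, a k < 2 * n := by
    intro k
    obtain ⟨i, hi⟩ := ha_row k
    rw [← hi]; exact (π (Sum.inl i)).isLt
  have ha_mono : StrictMono a := a.strictMono
  -- a row position is never a column position
  have hRC : ∀ i i' : Fin n, (π (Sum.inr i') : ℕ) ≠ (π (Sum.inl i) : ℕ) := by
    intro i i' h
    have h' : π (Sum.inr i') = π (Sum.inl i) := Fin.ext h
    exact Sum.inr_ne_inl (π.injective h')
  -- threshold rows (`A o`, with `A none = 2n`) and threshold columns (`a k + 1`)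
  let A : Option (Fin t) → ℕ := fun o => o.elim (2 * n) fun k => a k
  let xr : Option (Fin t) → (Fin n → Bool) := fun o i => decide ((π (Sum.inl i) : ℕ) < A o)
  let yc : Fin t → (Fin n → Bool) := fun k i => decide ((π (Sum.inr i) : ℕ) < a k + 1)
  have hA_le : ∀ o, A o ≤ 2 * n := by
    rintro (_ | k)
    · exact le_rfl
    · exact (ha_lt k).le
  have hA_notcol : ∀ o (i : Fin n), (π (Sum.inr i) : ℕ) ≠ A o := by
    rintro (_ | k) i
    · exact (π (Sum.inr i)).isLt.ne
    · obtain ⟨i₀, hi₀⟩ := ha_row k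
      show (π (Sum.inr i) : ℕ) ≠ a k
      rw [← hi₀]; exact hRC i₀ i
  -- entries of the submatrix
  have hQ : ∀ o k, M (xr o) (yc k) = (-1 : ℂ) ^ (min (A o) (a k + 1)) := by
    intro o k
    simp only [hM, Matrix.of_apply]
    exact twoAdicSign_entry_threshold n π (A o) (a k + 1) (hA_le o) (by have := ha_lt k; omega)
      (hA_notcol o) (ha_top k)
  set Q : Matrix (Option (Fin t)) (Fin t) ℂ := M.submatrix xr yc with hQdef
  -- the difference operator `L` (row `some i` minus row `none`) and `D = L * Q`
  set L : Matrix (Fin t) (Option (Fin t)) ℂ := Matrix.of fun i o => o.elim (-1) fun k => if k = i then 1 else 0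
    with hL
  set D : Matrix (Fin t) (Fin t) ℂ := L * Q with hD
  have hA_some : ∀ i : Fin t, A (some i) = a i := fun _ => rfl
  have hL_none : ∀ i : Fin t, L i none = -1 := fun _ => rfl
  have hL_some : ∀ i k' : Fin t, L i (some k') = if k' = i then 1 else 0 := fun _ _ => rfl
  have hDentry : ∀ i k, D i k = (-1 : ℂ) ^ (min (a i) (a k + 1)) - (-1) ^ (a k + 1) := by
    intro i k
    have hmin : min (A none) (a k + 1) = a k + 1 := by
      show min (2 * n) (a k + 1) = a k + 1
      have := ha_lt k; omega
    rw [hD, Matrix.mul_apply, Fintype.sum_option]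
    have h1 : L i none * Q none k = -(-1 : ℂ) ^ (a k + 1) := by
      rw [hQdef, Matrix.submatrix_apply, hQ, hmin, hL_none]
      ring
    have h2 : ∑ k' : Fin t, L i (some k') * Q (some k') k = (-1 : ℂ) ^ (min (a i) (a k + 1)) := by
      rw [Finset.sum_eq_single i]
      · rw [hQdef, Matrix.submatrix_apply, hQ, hA_some, hL_some, if_pos rfl, one_mul]
      · intro k' _ hk'
        rw [hL_some, if_neg hk', zero_mul]
      · intro h; exact absurd (Finset.mem_univ i) h
    rw [h1, h2]
    ring
  -- `D` is upper triangular with diagonal `2 (-1)^{a i}`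
  have hmin_lt : ∀ i k : Fin t, k < i → min (a i) (a k + 1) = a k + 1 := by
    intro i k hki
    have h1 : a k < a i := ha_mono hki
    obtain ⟨i₀, hi₀⟩ := ha_row i
    have h2 : a k + 1 ≠ a i := by rw [← hi₀]; exact (ha_top k i₀).symm
    omega
  have htri : D.BlockTriangular id := by
    intro i k hki
    rw [hDentry, hmin_lt i k hki, sub_self]
  have hdiag : ∀ i, D i i = 2 * (-1 : ℂ) ^ (a i) := by
    intro i
    rw [hDentry, min_eq_left (Nat.le_succ _), pow_succ]
    ring
  have hdet : D.det ≠ 0 := by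
    rw [Matrix.det_of_upperTriangular htri]
    refine Finset.prod_ne_zero_iff.mpr fun i _ => ?_
    rw [hdiag]
    exact mul_ne_zero two_ne_zero (pow_ne_zero _ (neg_ne_zero.mpr one_ne_zero))
  have hunit : IsUnit D := (Matrix.isUnit_iff_isUnit_det D).mpr (isUnit_iff_ne_zero.mpr hdet)
  have hrankD : D.rank = t := by
    rw [Matrix.rank_of_isUnit D hunit, Fintype.card_fin]
  -- assemble
  calc T.card = t := hcardS.symm
    _ = D.rank := hrankD.symm
    _ ≤ Q.rank := Matrix.rank_mul_le_right L Q
    _ ≤ M.rank := Matrix.rank_submatrix_le M xr yc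

/-! ### §3 Columns: the swapped cut -/

/-- ★ **The two-adic twin has cut rank `≥ #(tops of column runs)` on EVERY cut.**  The column version of
`card_rowRunTops_le_rank_twoAdicSign`: the number of column positions `p` with `p + 1` not a column position is at most
the rank.  (Swap the roles of rows and columns: the cut matrix of the swapped cut is the transpose.) [this file] -/
theorem card_colRunTops_le_rank_twoAdicSign (n : ℕ) (π : Fin n ⊕ Fin n ≃ Fin (2 * n)) :
    (Finset.univ.filter fun i : Fin n =>
        ∀ i' : Fin n, (π (Sum.inr i') : ℕ) ≠ (π (Sum.inr i) : ℕ) + 1).card ≤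
      (Matrix.of fun r c : Fin n → Bool =>
        (-1 : ℂ) ^ ((Nat.ofBits (fun k : Fin (2 * n) => Sum.elim r c (π.symm k)) + 1).factorization 2)).rank := by
  classical
  -- the swapped cut
  set π' : Fin n ⊕ Fin n ≃ Fin (2 * n) := (Equiv.sumComm (Fin n) (Fin n)).trans π with hπ'
  have h := card_rowRunTops_le_rank_twoAdicSign n π'
  have hinl : ∀ i : Fin n, π' (Sum.inl i) = π (Sum.inr i) := fun i => rfl
  simp only [hinl] at h
  refine h.trans (le_of_eq ?_)
  -- the matrix of `π'` is the transpose of the matrix of `π`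
  have hmat : (Matrix.of fun r c : Fin n → Bool =>
        (-1 : ℂ) ^ ((Nat.ofBits (fun k : Fin (2 * n) => Sum.elim r c (π'.symm k)) + 1).factorization 2)) =
      (Matrix.of fun r c : Fin n → Bool =>
        (-1 : ℂ) ^ ((Nat.ofBits (fun k : Fin (2 * n) => Sum.elim r c (π.symm k)) + 1).factorization 2)).transpose := by
    ext r c
    simp only [Matrix.of_apply, Matrix.transpose_apply]
    have hfun : (fun k : Fin (2 * n) => Sum.elim r c (π'.symm k)) =
        fun k : Fin (2 * n) => Sum.elim c r (π.symm k) := by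
      funext k
      simp only [hπ', Equiv.symm_trans_apply, Equiv.sumComm_symm, Equiv.sumComm_apply]
      cases π.symm k <;> rfl
    rw [hfun]
  rw [hmat, Matrix.rank_transpose]

end Summit.ValiantsHypothesis.ValiantsHypothesis.Theorems.LiouvilleSarnakLiouvilleCutRank.TwoAdicTwinRuns

end
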